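import Literature.MathematicalPhysics.QuantumFieldTheory.Balaban1983to89.B9B8KnitBondAvgDictionary
import Literature.MathematicalPhysics.QuantumFieldTheory.Balaban1983to89.B9B8AveragedBondsStraight
import Literature.MathematicalPhysics.QuantumFieldTheory.Balaban1983to89.B7Prop3GeneralLinearBound

/-!
# `Balaban1983to89.B9B8KnitColumnFlatness` — the (B)-line bond junction, file F1: THE FLATNESS ESTIMATE FOR THE COLUMNS OF THE
# COMPOSITE LINEAR AVERAGING — at a background `V` that is BOTH in [5] Prop. 5's regime (`pdev V < αL^{−2n}`) AND bondwise `ρ`-close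
# to `1`, every column of `LⁿQ_n(V)` at a single-bond bump is within `C(d,L)·(α + Lⁿρ)·Lⁿ·L^{−nd}·‖X‖` of the FLAT column `LⁿQ_n(1)`,
# UNIFORMLY IN `n` ([Balaban1985Averaging] (139)–(147) read column by column: «the constant C₁ depends on d and L», p. 39)

statement-level skeleton of published theorems with citation tags; proofs where landed; nothing here is a claim about the
Yang–Mills mass gap

Sub-row G-B8-T2S (unit `lit-balaban-t2s-1`, gen 8), RULING #10 road, crux (c′) = the averaging closeness (design
`lit-balaban-t2s-1/g7/BLINE-DESIGN-g7.md` §3–§4, g8 NOTES «F1»): the analytic heart of hypothesis (H1) of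
`B9B8KnitAveragingClosenessOfColumns.norm_QsY_aY_QY_sub_QQZdP_le_of_columns_sharp`.  By the exact gauge covariance of the
composite (`B9Eq332FieldAvgCovariance.linCovIter_rot`) the column of `LⁿQ_n(U₀)` at a bump equals the column of `LⁿQ_n(U₀^u)` at the
ROTATED bump, `u` the axial gauge from the corner of the coarse double box, in which `U₀^u` is bondwise `O(Lⁿ·α₀L^{−2n})`-close
to `1` on the box ([5] p. 24–25 «|V₀(b) − 1| < |b₋ − y|₁α₀»); the present file supplies the remaining estimate — the column of the
composite at a NEARLY FLAT regular background is close to the flat column — with NO chain expansion: a Duhamel telescoping over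
the FLAT composite `Φ_m = linQIter L · m` (additive, explicit one-stroke sums), whose one-step defect at level `j` is the frame part
of (124)–(126) (`B7Prop3GeneralLinearBound.norm_linQcov_sub_main_le`, `O(L²·pdev Ū^j)` with `pdev Ū^j < 2αL^{2(j−n)}` by Prop. 2 at
level `j`) plus the transport part of the main term (125) (`R(Ū^j(Γ_{c₋,x} ∪ [x, ·])) − 1 = O(|Γ|·(16dαL^{2(j−n)} + Lʲρ))` by
`B9B8AveragedBondsStraight.avgIter_straight` + telescoping) — both GEOMETRIC in `j`, whence the `n`-uniformity.
Print: [5] (122), (124)–(127) pp. 36–37, (139)–(147) pp. 39–40 («C₁ depends on d and L»), Prop. 2 (52)–(54) p. 26, p. 24–25, p. 38.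

WHAT IS PROVED (kernel, 0 sorry; theorems only, no `def`, no `… : Prop` fact, no `instance`).
* §1 the flat composite `Φ_m = linQIter L · m` as an operator: `linQIter_add'` ∕ `_sub'` ∕ `_zero'` ∕ `_finset_sum` (additivity),
  `linQIter_succ_left` (`Φ_m ∘ Φ_1 = Φ_{m+1}`), `thetaGen_le_one`, ★ `norm_linQIter_bump_le` (the flat column bound (147):
  `‖Φ_m(X·δ_b)(c)‖ ≤ 2·Lᵐ·L^{−md}·‖X‖`).
* §2 windows: `exists_winBase_of_inBox` (a coarse bond whose double box contains `y` IS a window bond of `y` — converse of `inBox_winBase`),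
  `winBase_injective`, the support of the columns (`linCovIter_zero_field`, `linCovIter_bump_eq_zero_of_not_inBox`, `linCovIter_bump_support`) and of
  the flat one-step on window-supported fields (`linQ_support_of_window`), and the window decomposition `eq_sum_bump_window`.
* §3 the one-step transport defect: `norm_hol_sub_one_le`, `tsum_seg_eq_sum` (the transported sum along a segment), `norm_conjR_tsum_seg_sub_asum_le`,
  `norm_smul_Q0cov_sub_linQ_le`, `sum_norm_bump_seg_le`, `sum_sum_norm_bump_le`, ★ `norm_smul_Q0cov_sub_linQ_bump_le`
  (`‖L·(Q₀(W) − Q₀(1))(X·δ_b)(c)‖ ≤ 2(d+1)Lσ·L·L^{−(d+1)}·L·‖X‖` for `W` bondwise `σ`-close to `1`), `Q0cov_add`, `smul_Q0cov_sub_linQ_finset_sum`.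
* §4 the regime at level `j` (`V` unitary, `pdev V < α(Lⁿ)⁻²`, `α ≤ α_Q`, `‖V(b) − 1‖ ≤ ρ`): `windows_of_alphaQ`, `level_data` (Prop. 2 at level `j`),
  `level_loops` (block loops `≤ ε_j ≤ 1/8`), `level_close` (`‖Ū^j(b) − 1‖ ≤ 16dα(Lʲ∕Lⁿ)² + Lʲρ`), `reg17_of_pdev`, `norm_column_le` ((147) at every level),
  ★★ `norm_defect_le` (THE ONE-STEP DEFECT `‖F_{j+1} − L·Q₀(1)F_j‖ ≤ κ_j·λ_j·‖X‖`) and `defect_eq_zero_of_not_inBox` (its support).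
* §5 `lam_mul_lam`, `geom_sum_le_pow_sub_one`, ★★ `duhamel` (the induction over the flat composite, abstract in the level coefficients),
  ★★★ `norm_linCovIter_bump_sub_linQIter_le_sum` — THE FLATNESS ESTIMATE with the level coefficients summed — and
  ★★★ `norm_linCovIter_bump_sub_linQIter_le` — UNIFORM IN `n`:
  `‖LⁿQ_n(V)(X·δ_b)(c) − LⁿQ_n(1)(X·δ_b)(c)‖ ≤ 4d·L^d·[(3200(d+1)²(d+4)L³ + 128d²(d+1)L³L^{−(d+1)})·α + 8d(d+1)L³L^{−(d+1)}·Lⁿρ]·Lⁿ·L^{−nd}·‖X‖`.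

HONEST SCOPE.  An estimate about [5]'s composite linear averaging on `ℤᵈ` at a nearly flat background, with `L`-dependent constants
exactly as print allows; the gauge step, the torus ∕ def-Y identification and (H2)–(H3) are NOT here (files F2–F3 of the seat);
count-neutral; nothing continuum ∕ ℝ⁴ ∕ OS ∕ mass gap ∕ Clay — the Yang–Mills mass gap is NOT proved here.  NEW file; [5]'s files,
`B9Eq316AveragingTransposeZd`, `B9B8AveragedBondsStraight`, c2's dictionary are used BY NAME, nothing landed is modified.
-/

noncomputable section

namespace Literature.MathematicalPhysics.QuantumFieldTheory.Balaban1983to89.B9B8KnitColumnFlatness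

open scoped BigOperators
open B7Prop1Explicit renaming Site → LSite
open B7Prop1Explicit hiding Site
open B7Prop1Local (InBox AgreeOn loK bondHiK bondHi avgIter_congr add_e_apply)
open B7Prop2Explicit (pdev avgIter avgIter_zero avgIter_succ unitaryUnits avgClosed_unitaryUnits avgIter_mem prop2_explicit_lt_two
  le_pdev pdev_nonneg C0 c2' C0_pos norm_Wcx_sub_one_le)
open B7Prop3Flat (linQ Q0form linQ_eq_smul_Q0form)
open B7Prop3GeneralRotated (tsum tsum_cons tsum_nil conjR_mul_left norm_conjR_le)
open B7Prop3GeneralLinear (Q0cov linQcov linQcov_one_left)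
open B7Prop3GeneralLinearBound (norm_linQcov_sub_main_le norm_conjR_sub_self_le)
open B7Prop4Flat (linQIter linQIter_zero linQIter_succ linQIter_eq_linQ_pow linQ_eq_sum norm_linQIter_le linQ_sub)
open B7Prop4GeneralLevels (linCovIter linCovIter_succ linCovIter_zero)
open B7Prop5Flat (bump norm_bump_le BondIn inBox_nest linQ_add bump_eq_zero_of)
open B7Prop5GeneralLevels (thetaGen)
open B7Eq78Linearization (conjR conjR_apply conjR_add conjR_sub conjR_one)
open B7Eq92Concrete (avgIter_one)
open B9Eq316AveragingTransposeZd (winBase inBox_winBase alphaQ alphaQ_pos C0_mul_alphaQ_le four_mul_alphaQ_le Reg17 reg17_one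
  norm_linCovIter_bump_le_of_reg17)
open B9B8AveragedBondsStraight (avgIter_straight)
open B9B8KnitBondAvgDictionary (linCovIter_one_eq_linQIter)

variable {D : ℕ} {𝔸 : Type} [CStarAlgebra 𝔸]

/-! ## §1 The flat composite `Φ_m = linQIter L · m` as an additive operator, and its column bound -/

section Flat

variable (L : ℕ)

/-- `Φ_1` is additive: `L·Q₀(F + G) = L·Q₀F + L·Q₀G`, as functions. [cite: Balaban1985Averaging, (125) p.36, bookkeeping] -/
theorem linQ_add_fun (F G : LSite D → Fin D → 𝔸) :
    (fun z κ => linQ L (F + G) ((L : ℤ) • z) κ) = (fun z κ => linQ L F ((L : ℤ) • z) κ) + fun z κ => linQ L G ((L : ℤ) • z) κ := by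
  funext z κ
  rw [Pi.add_apply, Pi.add_apply, linQ_add]

/-- `Φ_m` is additive. [cite: Balaban1985Averaging, (127) p.37, p.39 («A composition of k operators Q is the operator Q_k»)] -/
theorem linQIter_add' (F G : LSite D → Fin D → 𝔸) : ∀ m : ℕ, linQIter L (F + G) m = linQIter L F m + linQIter L G m
  | 0 => rfl
  | m + 1 => by
    funext z κ
    rw [Pi.add_apply, Pi.add_apply, linQIter_succ, linQIter_succ, linQIter_succ, linQIter_add' F G m, linQ_add]

/-- `Φ_m 0 = 0`. [cite: Balaban1985Averaging, (127) p.37, bookkeeping] -/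
theorem linQIter_zero' : ∀ m : ℕ, linQIter L (0 : LSite D → Fin D → 𝔸) m = 0
  | 0 => rfl
  | m + 1 => by
    funext z κ
    rw [linQIter_succ, linQIter_zero' m, Pi.zero_apply, Pi.zero_apply, linQ_eq_sum]
    simp

/-- `Φ_m` is additive over finite sums. [cite: Balaban1985Averaging, (127) p.37, bookkeeping] -/
theorem linQIter_finset_sum {ι : Type*} (s : Finset ι) (F : ι → LSite D → Fin D → 𝔸) (m : ℕ) :
    linQIter L (∑ i ∈ s, F i) m = ∑ i ∈ s, linQIter L (F i) m := by
  classical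
  induction s using Finset.induction_on with
  | empty => rw [Finset.sum_empty, Finset.sum_empty, linQIter_zero']
  | insert a s ha ih => rw [Finset.sum_insert ha, Finset.sum_insert ha, linQIter_add', ih]

/-- `Φ_m(F − G) = Φ_m F − Φ_m G`. [cite: Balaban1985Averaging, (127) p.37, bookkeeping] -/
theorem linQIter_sub' (F G : LSite D → Fin D → 𝔸) (m : ℕ) : linQIter L (F - G) m = linQIter L F m - linQIter L G m := by
  have h := linQIter_add' L (F - G) G m
  rw [sub_add_cancel] at h
  rw [h, add_sub_cancel_right]

/-- **`Φ_m ∘ Φ_1 = Φ_{m+1}`**: the flat composite of the one-step flat average is the next flat composite (the flat tower is the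
same operator at every level). [cite: Balaban1985Averaging, p.38 («Q_{j+1}(U₀) = Q(Ū₀ʲ)Q_j(U₀)»), p.39] -/
theorem linQIter_succ_left (F : LSite D → Fin D → 𝔸) :
    ∀ m : ℕ, linQIter L (fun z κ => linQ L F ((L : ℤ) • z) κ) m = linQIter L F (m + 1)
  | 0 => rfl
  | m + 1 => by
    funext z κ
    rw [linQIter_succ, linQIter_succ_left F m, linQIter_succ]

variable [Nontrivial 𝔸]

/-- `θ(α) ≤ 1` inside the window `α ≤ α_Q(d, L)` (`L ≥ 1`). [cite: Balaban1985Averaging, (145)–(147) p.40] -/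
theorem thetaGen_le_one {L : ℕ} (hL : 1 ≤ L) {α : ℝ} (hαQ : α ≤ alphaQ D L) : thetaGen D L α ≤ 1 := by
  have hL0 : (0 : ℝ) < L := by exact_mod_cast hL
  have h : alphaQ D L ≤ 1 / (25600 * ((D : ℝ) + 1) ^ 2 * ((D : ℝ) + 4) * (L : ℝ) ^ (D + 1)) := min_le_right _ _
  have hpos : (0 : ℝ) < 25600 * ((D : ℝ) + 1) ^ 2 * ((D : ℝ) + 4) * (L : ℝ) ^ (D + 1) := by positivity
  unfold thetaGen
  calc 3200 * ((D : ℝ) + 1) * ((D : ℝ) + 4) * (L : ℝ) ^ (D + 1) * α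
      ≤ 3200 * ((D : ℝ) + 1) * ((D : ℝ) + 4) * (L : ℝ) ^ (D + 1) * (1 / (25600 * ((D : ℝ) + 1) ^ 2 * ((D : ℝ) + 4) * (L : ℝ) ^ (D + 1))) :=
        mul_le_mul_of_nonneg_left (hαQ.trans h) (by positivity)
    _ = 1 / (8 * ((D : ℝ) + 1)) := by field_simp; ring
    _ ≤ 1 := by
        rw [div_le_one (by positivity)]
        have : (0 : ℝ) ≤ D := Nat.cast_nonneg D
        linarith

/-- ★ **THE FLAT COLUMN BOUND (147) FOR `Φ_m`**: `‖Φ_m(X·δ_{(y,μ)})(z, κ)‖ ≤ 2·Lᵐ·(Lᵐ)^{−d}·‖X‖` (`L ≥ 2`) — [5] (147) «|Q_k(U₀; c, b)| ≦ 1 + 2C′₁α₀»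
at `U₀ = 1`, read through `B9Eq316AveragingTransposeZd.norm_linCovIter_bump_le_of_reg17` at the unit background (which lies in the class for
every window, `reg17_one`) and `linCovIter L 1 = linQIter` (`linCovIter_one_eq_linQIter`). [cite: Balaban1985Averaging, (147) p.40, (141) p.39] -/
theorem norm_linQIter_bump_le {L : ℕ} (hL : 2 ≤ L) (y : LSite D) (μ : Fin D) (X : 𝔸) (m : ℕ) (z : LSite D) (κ : Fin D) :
    ‖linQIter L (bump y μ X) m z κ‖ ≤ 2 * ((L : ℝ) ^ m * (((L : ℝ) ^ m) ^ D)⁻¹) * ‖X‖ := by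
  have hL1 : 1 ≤ L := le_trans (by norm_num) hL
  have hαQ := alphaQ_pos D hL1
  have h1 : ∀ x κ', (1 : LSite D → Fin D → 𝔸ˣ) x κ' ∈ unitaryUnits 𝔸 := fun _ _ => Subgroup.one_mem _
  have hreg : Reg17 L m (fun _ => (Set.univ : Set (LSite D))) (alphaQ D L) (1 : LSite D → Fin D → 𝔸ˣ) := reg17_one hL1 hαQ
  have h := norm_linCovIter_bump_le_of_reg17 hL hαQ le_rfl h1 hreg le_rfl z κ (fun _ _ => Set.mem_univ _) y μ X
  have e : linCovIter L (1 : LSite D → Fin D → 𝔸ˣ) (bump y μ X) m z κ = linQIter L (bump y μ X) m z κ :=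
    congrFun (congrFun (linCovIter_one_eq_linQIter hL1 (bump y μ X) (norm_nonneg X) (fun x κ' => norm_bump_le y μ X x κ') m) z) κ
  rw [← e]
  refine h.trans (mul_le_mul_of_nonneg_right (mul_le_mul_of_nonneg_right ?_ (by positivity)) (norm_nonneg _))
  have := thetaGen_le_one (D := D) hL1 (le_refl (alphaQ D L))
  linarith

end Flat

/-! ## §2 Windows: which coarse bonds see a fine site, supports of the columns, the window decomposition -/

section Windows

variable (L : ℕ)

omit [CStarAlgebra 𝔸] in
/-- **A COARSE BOND WHOSE DOUBLE BOX CONTAINS `y` IS A WINDOW BOND OF `y`**: if `y ∈ [Lʲw, Lʲw + (Lʲ − 1)𝟙 + Lʲe_κ]` then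
`w = winBase L j y κ t` for `t = 0` or `t = 1` (the converse of `inBox_winBase`). [cite: Balaban1985Averaging, p.24 (after (43)), (141) p.39] -/
theorem exists_winBase_of_inBox (hL : 1 ≤ L) {j : ℕ} {w y : LSite D} {κ : Fin D} (h : InBox (loK L j w) (bondHiK L j w κ) y) :
    ∃ t : Fin 2, w = winBase L j y κ t := by
  have hP : (0 : ℤ) < (L : ℤ) ^ j := by positivity
  -- off the direction `κ` the coordinate is the quotient; along `κ` it is the quotient or one less
  have hlo : ∀ i, (L : ℤ) ^ j * w i ≤ y i := fun i => by have := (h i).1; simpa [loK] using this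
  have hi : ∀ i, i ≠ κ → w i = y i / (L : ℤ) ^ j := by
    intro i hiκ
    have h2 : y i ≤ (L : ℤ) ^ j * w i + ((L : ℤ) ^ j - 1) := by have := (h i).2; simpa [bondHiK, hiκ] using this
    have h1 := hlo i
    exact ((Int.ediv_eq_iff_of_pos hP).2 ⟨by linarith, by linarith⟩).symm
  have h2 : y κ ≤ (L : ℤ) ^ j * w κ + ((L : ℤ) ^ j - 1) + (L : ℤ) ^ j := by have := (h κ).2; simpa [bondHiK] using this
  have h1 := hlo κ
  by_cases hc : y κ < (L : ℤ) ^ j * w κ + (L : ℤ) ^ j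
  · refine ⟨0, funext fun i => ?_⟩
    by_cases hiκ : i = κ
    · subst hiκ
      have hq : y i / (L : ℤ) ^ j = w i := (Int.ediv_eq_iff_of_pos hP).2 ⟨by linarith, by linarith⟩
      simp [winBase, hq]
    · simp only [winBase, if_neg hiκ, sub_zero]; exact hi i hiκ
  · refine ⟨1, funext fun i => ?_⟩
    by_cases hiκ : i = κ
    · subst hiκ
      have hq : y i / (L : ℤ) ^ j = w i + 1 := (Int.ediv_eq_iff_of_pos hP).2 ⟨by linarith, by linarith⟩
      simp [winBase, hq]
    · simp only [winBase, if_neg hiκ, sub_zero]; exact hi i hiκ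

omit [CStarAlgebra 𝔸] in
/-- the two window bonds of one direction are distinct (`t ↦ winBase L j y κ t` is injective). [cite: Balaban1985Averaging, p.24, bookkeeping] -/
theorem winBase_injective (j : ℕ) (y : LSite D) (κ : Fin D) : Function.Injective fun t : Fin 2 => winBase L j y κ t := by
  intro t t' h
  have hκ : y κ / (L : ℤ) ^ j - ((t : ℕ) : ℤ) = y κ / (L : ℤ) ^ j - ((t' : ℕ) : ℤ) := by simpa [winBase] using congrFun h κ
  exact Fin.ext (by omega)

/-- locality of the one-step linear part (122), jointly in `(V₀, A)` (private twin of the lineage's lemma). [cite: Balaban1985Averaging, (122) p.36, p.24] -/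
private theorem linQcov_congr (hL : 1 ≤ L) (q : LSite D) (κ : Fin D) {V₀ V₀' : LSite D → Fin D → 𝔸ˣ}
    {A A' : LSite D → Fin D → 𝔸} (h₀ : AgreeOn q (bondHi L q κ) V₀ V₀') (hA : AgreeOn q (bondHi L q κ) A A') :
    linQcov L V₀ A q κ = linQcov L V₀' A' q κ := by
  unfold linQcov
  congr 1
  funext t
  exact B7LocalityGeneral.Qcov_congr L hL q κ h₀ fun x μ hx hxe => by
    show t • A x μ = t • A' x μ
    rw [hA x μ hx hxe]

/-- locality of the composite `LʲQ_j(U₀)A(c)` in the bonds of `Bʲ(c₋) ∪ Bʲ(c₊)`, jointly in `(U₀, A)` (private twin).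
[cite: Balaban1985Averaging, p.24 (after (43)), p.38 (before (133))] -/
private theorem linCovIter_congr (hL : 1 ≤ L) :
    ∀ (j : ℕ) {U₀ U₀' : LSite D → Fin D → 𝔸ˣ} {B B' : LSite D → Fin D → 𝔸} (z : LSite D) (κ : Fin D),
      AgreeOn (loK L j z) (bondHiK L j z κ) U₀ U₀' → AgreeOn (loK L j z) (bondHiK L j z κ) B B' →
        linCovIter L U₀ B j z κ = linCovIter L U₀' B' j z κ
  | 0, U₀, U₀', B, B', z, κ, _, h => by
    refine h z κ (fun i => ?_) (fun i => ?_)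
    · simp only [loK, bondHiK, pow_zero, one_mul]; split_ifs <;> omega
    · simp only [loK, bondHiK, pow_zero, one_mul, add_e_apply]; split_ifs <;> omega
  | j + 1, U₀, U₀', B, B', z, κ, h₀, h => by
    rw [linCovIter_succ, linCovIter_succ]
    refine linQcov_congr L hL _ κ (fun x μ hx hxe => ?_) (fun x μ hx hxe => ?_)
    · exact avgIter_congr L hL j x μ fun p ν hp hpν =>
        h₀ p ν (inBox_nest L j z κ ⟨hx, hxe⟩ hp) (inBox_nest L j z κ ⟨hx, hxe⟩ hpν)
    · exact linCovIter_congr hL j x μ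
        (fun p ν hp hpν => h₀ p ν (inBox_nest L j z κ ⟨hx, hxe⟩ hp) (inBox_nest L j z κ ⟨hx, hxe⟩ hpν))
        (fun p ν hp hpν => h p ν (inBox_nest L j z κ ⟨hx, hxe⟩ hp) (inBox_nest L j z κ ⟨hx, hxe⟩ hpν))

/-- `LʲQ_j(U₀)0 = 0`. [cite: Balaban1985Averaging, (127) p.37] -/
theorem linCovIter_zero_field (U₀ : LSite D → Fin D → 𝔸ˣ) : ∀ j : ℕ, linCovIter L U₀ (0 : LSite D → Fin D → 𝔸) j = 0
  | 0 => rfl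
  | j + 1 => by
    funext z κ
    rw [linCovIter_succ, linCovIter_zero_field U₀ j]
    simp [linQcov]

/-- **THE COLUMN VANISHES OFF THE WINDOW**: if `y ∉ [Lʲw, Lʲw + (Lʲ−1)𝟙 + Lʲe_κ]` then `LʲQ_j(U₀)(X·δ_{(y,μ)})(w, κ) = 0` (locality: the
bump agrees with `0` on the box). [cite: Balaban1985Averaging, p.24 (after (43)), (141) p.39] -/
theorem linCovIter_bump_eq_zero_of_not_inBox (hL : 1 ≤ L) (U₀ : LSite D → Fin D → 𝔸ˣ) {j : ℕ} {w y : LSite D} {κ : Fin D}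
    (h : ¬ InBox (loK L j w) (bondHiK L j w κ) y) (μ : Fin D) (X : 𝔸) : linCovIter L U₀ (bump y μ X) j w κ = 0 := by
  have hag : AgreeOn (loK L j w) (bondHiK L j w κ) (bump y μ X) 0 := by
    intro x ν hx _
    have hxy : ¬ (x = y ∧ ν = μ) := fun hh => h (hh.1 ▸ hx)
    rw [bump_eq_zero_of X hxy, Pi.zero_apply, Pi.zero_apply]
  rw [linCovIter_congr L hL j w κ (fun _ _ _ _ => rfl) hag, linCovIter_zero_field, Pi.zero_apply, Pi.zero_apply]

/-- **THE SUPPORT OF A COLUMN IS THE WINDOW**: `LʲQ_j(U₀)(X·δ_{(y,μ)})(w, κ) ≠ 0 ⟹ w = winBase L j y κ t` for some `t`.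
[cite: Balaban1985Averaging, p.24 (after (43)), (141) p.39] -/
theorem linCovIter_bump_support (hL : 1 ≤ L) (U₀ : LSite D → Fin D → 𝔸ˣ) {j : ℕ} {w y : LSite D} {κ : Fin D} {μ : Fin D} {X : 𝔸}
    (h : linCovIter L U₀ (bump y μ X) j w κ ≠ 0) : ∃ t : Fin 2, w = winBase L j y κ t := by
  by_contra hne
  exact h (linCovIter_bump_eq_zero_of_not_inBox L hL U₀ (fun hin => hne (exists_winBase_of_inBox L hL hin)) μ X)

/-- **THE FLAT ONE-STEP OF A WINDOW-SUPPORTED FIELD IS WINDOW-SUPPORTED ONE LEVEL UP**: if `G` vanishes at every level-`j` bond whose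
double box misses `y`, then `L·Q₀(G)(Lz, κ) ≠ 0 ⟹ y ∈ [L^{j+1}z, …]` (the one-stroke sum reads `G` on bonds of the `L`-box of `⟨Lz, Lz + Le_κ⟩`,
`inBox_nest`). [cite: Balaban1985Averaging, (125) p.36, p.24] -/
theorem linQ_support_of_window {j : ℕ} {y : LSite D} {G : LSite D → Fin D → 𝔸}
    (hG : ∀ w κ, ¬ InBox (loK L j w) (bondHiK L j w κ) y → G w κ = 0) {z : LSite D} {κ : Fin D}
    (h : linQ L G ((L : ℤ) • z) κ ≠ 0) : InBox (loK L (j + 1) z) (bondHiK L (j + 1) z κ) y := by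
  classical
  by_contra hny
  apply h
  rw [linQ_eq_sum]
  refine Finset.sum_eq_zero fun r _ => ?_
  rw [smul_eq_zero]
  refine Or.inr (Finset.sum_eq_zero fun i _ => hG _ _ fun hin => hny (inBox_nest L j z κ ?_ hin))
  -- the bond `⟨Lz + r + ie_κ, · + e_κ⟩` lies in the `L`-box of `⟨Lz, Lz + Le_κ⟩`
  have hr : ∀ ν, (0 : ℤ) ≤ ((r ν : ℕ) : ℤ) ∧ ((r ν : ℕ) : ℤ) ≤ (L : ℤ) - 1 := fun ν => ⟨by positivity, by have := (r ν).2; omega⟩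
  have hi : (0 : ℤ) ≤ ((i : ℕ) : ℤ) ∧ ((i : ℕ) : ℤ) ≤ (L : ℤ) - 1 := ⟨by positivity, by have := i.2; omega⟩
  refine ⟨fun ν => ?_, fun ν => ?_⟩
  · simp only [bondHi, Pi.add_apply, Pi.smul_apply, smul_eq_mul, boxVec, e_apply]
    obtain ⟨h1, h2⟩ := hr ν
    split_ifs <;> constructor <;> nlinarith
  · simp only [bondHi, Pi.add_apply, Pi.smul_apply, smul_eq_mul, boxVec, e_apply]
    obtain ⟨h1, h2⟩ := hr ν
    split_ifs <;> constructor <;> nlinarith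

/-- **THE WINDOW DECOMPOSITION**: a bond field that vanishes at every level-`j` bond whose double box misses `y` is the (finite) sum of
its single-bond bumps at the `2d` window bonds of `y`. [cite: Balaban1985Averaging, (141) p.39, p.24] -/
theorem eq_sum_bump_window (hL : 1 ≤ L) {j : ℕ} {y : LSite D} {G : LSite D → Fin D → 𝔸}
    (hG : ∀ w κ, ¬ InBox (loK L j w) (bondHiK L j w κ) y → G w κ = 0) :
    G = ∑ κ : Fin D, ∑ t : Fin 2, bump (winBase L j y κ t) κ (G (winBase L j y κ t) κ) := by
  classical
  funext x ν
  rw [Finset.sum_apply, Finset.sum_apply]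
  simp only [Finset.sum_apply]
  by_cases hx : ∃ t : Fin 2, x = winBase L j y ν t
  · obtain ⟨t₀, rfl⟩ := hx
    rw [Finset.sum_eq_single ν]
    · rw [Finset.sum_eq_single t₀]
      · simp [bump]
      · intro t _ ht
        rw [bump_eq_zero_of]
        rintro ⟨h1, _⟩
        exact ht (winBase_injective L j y ν h1).symm
      · intro h; exact absurd (Finset.mem_univ _) h
    · intro κ _ hκ
      refine Finset.sum_eq_zero fun t _ => bump_eq_zero_of _ ?_
      rintro ⟨_, h2⟩
      exact hκ h2.symm
    · intro h; exact absurd (Finset.mem_univ _) h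
  · have h0 : G x ν = 0 := hG x ν fun hin => hx (exists_winBase_of_inBox L hL hin)
    rw [h0]
    symm
    refine Finset.sum_eq_zero fun κ _ => Finset.sum_eq_zero fun t _ => bump_eq_zero_of _ ?_
    rintro ⟨h1, h2⟩
    exact hx ⟨t, by rw [h1, h2]⟩

end Windows

/-! ## §3 The one-step transport defect: `L·(Q₀(W) − Q₀(1))` on a bump, `W` bondwise close to `1` -/

section Transport

variable (L : ℕ)

omit [CStarAlgebra 𝔸] in
/-- `R(X)·0 = 0`. [folklore] -/
private theorem conjR_zero' {𝔹 : Type*} [NormedRing 𝔹] (X : 𝔹ˣ) : conjR X (0 : 𝔹) = 0 := by simp [conjR_apply]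

omit [CStarAlgebra 𝔸] in
/-- `R(1)Y = Y`. [folklore] -/
private theorem one_conjR' {𝔹 : Type*} [NormedRing 𝔹] (Y : 𝔹) : conjR (1 : 𝔹ˣ) Y = Y := by simp [conjR_apply]

/-- `R(X)` passes through finite sums. [folklore] -/
private theorem conjR_finset_sum {𝔹 : Type*} [NormedRing 𝔹] (X : 𝔹ˣ) {ι : Type*} (s : Finset ι) (f : ι → 𝔹) :
    conjR X (∑ i ∈ s, f i) = ∑ i ∈ s, conjR X (f i) := by
  classical
  induction s using Finset.induction_on with
  | empty => rw [Finset.sum_empty, Finset.sum_empty, conjR_zero']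
  | insert a s ha ih => rw [Finset.sum_insert ha, Finset.sum_insert ha, conjR_add, ih]

/-- `‖XY − 1‖ ≤ ‖X − 1‖ + ‖Y − 1‖` for `‖Y‖ ≤ 1`. [folklore] -/
private theorem norm_mul_sub_one_le_add {X Y : 𝔸} (hY : ‖Y‖ ≤ 1) : ‖X * Y - 1‖ ≤ ‖X - 1‖ + ‖Y - 1‖ := by
  rw [show X * Y - 1 = (X - 1) * Y + (Y - 1) by noncomm_ring]
  exact (norm_add_le _ _).trans (add_le_add ((norm_mul_le _ _).trans (mul_le_of_le_one_right (norm_nonneg _) hY)) le_rfl)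

/-- `(R_{0,x}0)(Γ) = 0`. [folklore] -/
private theorem tsum_zero_field (W : LSite D → Fin D → 𝔸ˣ) :
    ∀ (x : LSite D) (w : List (Letter D)), tsum W (0 : LSite D → Fin D → 𝔸) x w = 0
  | x, [] => rfl
  | x, l :: w => by
    rw [tsum_cons, tsum_zero_field W (x + l.vec) w, conjR_zero', add_zero]
    simp [B7Prop3GeneralRotated.tstep, conjR_zero']

/-- `(Q₀(W)0)_c = 0`. [folklore] -/
private theorem Q0cov_zero_field (W : LSite D → Fin D → 𝔸ˣ) (q : LSite D) (κ : Fin D) :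
    Q0cov L W (0 : LSite D → Fin D → 𝔸) q κ = 0 := by
  simp [Q0cov, tsum_zero_field, conjR_zero']

/-- `L·(Q₀(1)0)_c = 0`. [folklore] -/
private theorem linQ_zero_field (q : LSite D) (κ : Fin D) : linQ L (0 : LSite D → Fin D → 𝔸) q κ = 0 := by
  simp [linQ_eq_sum]

variable [Nontrivial 𝔸]

/-- **`‖W(Γ) − 1‖ ≤ |Γ|·σ`** for a `U1` background bondwise `σ`-close to `1` (telescoping; p. 25 l. 3 «|V₀(b) − 1| < |b₋ − y|₁α₀»).
[cite: Balaban1985Averaging, (9) p.18, p.25] -/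
theorem norm_hol_sub_one_le {W : LSite D → Fin D → 𝔸ˣ} (hW : ∀ x κ, W x κ ∈ U1 𝔸) {σ : ℝ} (hσ : ∀ x κ, ‖(W x κ : 𝔸) - 1‖ ≤ σ) :
    ∀ (x : LSite D) (w : List (Letter D)), ‖((hol W x w : 𝔸ˣ) : 𝔸) - 1‖ ≤ w.length * σ
  | x, [] => by simp
  | x, l :: w => by
    rw [hol_cons, Units.val_mul, List.length_cons, Nat.cast_succ, add_mul, one_mul, add_comm ((w.length : ℝ) * σ)]
    refine (norm_mul_sub_one_le_add (mem_U1.1 (hol_mem hW _ w)).1).trans (add_le_add ?_ (norm_hol_sub_one_le hW hσ (x + l.vec) w))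
    obtain ⟨μ, b⟩ := l
    cases b
    · rw [stepHol_false]
      exact (norm_inv_sub_one_le (hW _ _)).trans (hσ _ _)
    · rw [stepHol_true]; exact hσ _ _

omit [Nontrivial 𝔸] in
/-- **THE TRANSPORTED SUM ALONG A STRAIGHT SEGMENT**: `(R_{0,x}B)([x, x + ne_κ]) = Σ_{s<n} R(W(x, x + se_κ))·B(x + se_κ, κ)` — (58) with «the product
over b replaced by the sum» (p. 28) along the segment. [cite: Balaban1985Averaging, (58) p.27, p.28, (125) p.36] -/
theorem tsum_seg_eq_sum (W : LSite D → Fin D → 𝔸ˣ) (B : LSite D → Fin D → 𝔸) (κ : Fin D) :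
    ∀ (n : ℕ) (x : LSite D), tsum W B x (seg κ n) = ∑ s ∈ Finset.range n, conjR (hol W x (seg κ s)) (B (x + (s : ℤ) • e κ) κ)
  | 0, x => by simp
  | n + 1, x => by
    have ih := tsum_seg_eq_sum W B κ n (x + e κ)
    have hk : ∀ k : ℕ, conjR (stepHol W x (κ, true)) (conjR (hol W (x + e κ) (seg κ (k : ℤ))) (B (x + e κ + (k : ℤ) • e κ) κ)) =
        conjR (hol W x (seg κ ((k + 1 : ℕ) : ℤ))) (B (x + ((k + 1 : ℕ) : ℤ) • e κ) κ) := by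
      intro k
      have e1 : hol W x (seg κ ((k + 1 : ℕ) : ℤ)) = stepHol W x (κ, true) * hol W (x + e κ) (seg κ (k : ℤ)) := by
        rw [seg_natCast κ (k + 1), List.replicate_succ, hol_cons, B7Prop1Explicit.Letter.vec_true, seg_natCast]
      have e2 : x + ((k + 1 : ℕ) : ℤ) • e κ = x + e κ + (k : ℤ) • e κ := by
        simp only [Nat.cast_succ, add_smul, one_smul]; abel
      rw [← conjR_mul_left, e1, e2]
    have h0 : conjR (hol W x (seg κ ((0 : ℕ) : ℤ))) (B (x + ((0 : ℕ) : ℤ) • e κ) κ) = B x κ := by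
      rw [seg_natCast, List.replicate_zero, hol_nil, Nat.cast_zero, zero_smul, add_zero]
      simp [conjR_apply]
    rw [seg_natCast, List.replicate_succ, tsum_cons, B7Prop1Explicit.Letter.vec_true, ← seg_natCast, ih, conjR_finset_sum,
      Finset.sum_range_succ', h0, add_comm]
    simp only [hk]
    congr 1

/-- **THE TRANSPORT DEFECT ALONG ONE SEGMENT**: for a `U1` background `W` bondwise `σ`-close to `1` and a transporter `h ∈ U1` with `‖h − 1‖ ≤ τ`,
`‖R(h)(R_{0,x}B)([x, x + ne_κ]) − B([x, x + ne_κ])‖ ≤ 2(τ + nσ)·Σ_{s<n}‖B(x + se_κ, κ)‖` (each summand is `[R(h·W([x, x+se_κ])) − 1]B_s`,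
`‖R(u)Z − Z‖ ≤ 2‖u − 1‖‖Z‖`). [cite: Balaban1985Averaging, (124)–(126) p.36, (58) p.27] -/
theorem norm_conjR_tsum_seg_sub_asum_le {W : LSite D → Fin D → 𝔸ˣ} (hW : ∀ x κ, W x κ ∈ U1 𝔸) {σ : ℝ} (hσ : ∀ x κ, ‖(W x κ : 𝔸) - 1‖ ≤ σ)
    {h : 𝔸ˣ} (hh : h ∈ U1 𝔸) {τ : ℝ} (hτ : ‖(h : 𝔸) - 1‖ ≤ τ) (B : LSite D → Fin D → 𝔸) (x : LSite D) (κ : Fin D) (n : ℕ) :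
    ‖conjR h (tsum W B x (seg κ n)) - asum B x (seg κ n)‖ ≤ 2 * (τ + n * σ) * ∑ s ∈ Finset.range n, ‖B (x + (s : ℤ) • e κ) κ‖ := by
  have hσ0 : 0 ≤ σ := (norm_nonneg _).trans (hσ x κ)
  rw [tsum_seg_eq_sum, asum_seg_natCast, conjR_finset_sum, ← Finset.sum_sub_distrib, Finset.mul_sum]
  refine (norm_sum_le _ _).trans (Finset.sum_le_sum fun s hs => ?_)
  have hs' : (s : ℝ) ≤ n := by exact_mod_cast (Finset.mem_range.1 hs).le
  rw [← conjR_mul_left]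
  have hmem : h * hol W x (seg κ s) ∈ U1 𝔸 := (U1 𝔸).mul_mem hh (hol_mem hW _ _)
  have hdev : ‖((h * hol W x (seg κ s) : 𝔸ˣ) : 𝔸) - 1‖ ≤ τ + n * σ := by
    rw [Units.val_mul]
    refine (norm_mul_sub_one_le_add (mem_U1.1 (hol_mem hW _ _)).1).trans (add_le_add hτ ?_)
    refine (norm_hol_sub_one_le hW hσ x _).trans ?_
    rw [length_seg, Int.natAbs_natCast]
    exact mul_le_mul_of_nonneg_right hs' hσ0
  calc ‖conjR (h * hol W x (seg κ ↑s)) (B (x + (s : ℤ) • e κ) κ) - B (x + (s : ℤ) • e κ) κ‖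
      ≤ 2 * (τ + n * σ) * ‖B (x + (s : ℤ) • e κ) κ‖ := norm_conjR_sub_self_le hmem hdev _
    _ = _ := rfl

/-- **THE ONE-STEP TRANSPORT DEFECT OF THE MAIN TERM (125)**: `‖L·(Q₀(W)B)_c − L·(Q₀(1)B)_c‖ ≤ 2(d+1)Lσ·L·L^{−(d+1)}·Σ_{x∈B(c₋)}Σ_{s<L}‖B([x+se_κ])‖`
for a `U1` background `W` bondwise `σ`-close to `1` (the tree contour `Γ_{c₋,x}` has `≤ dL` bonds, the segment `≤ L`).
[cite: Balaban1985Averaging, (125) p.36, (124)–(126) p.36, p.24] -/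
theorem norm_smul_Q0cov_sub_linQ_le (hL : 1 ≤ L) {W : LSite D → Fin D → 𝔸ˣ} (hW : ∀ x κ, W x κ ∈ U1 𝔸) {σ : ℝ}
    (hσ : ∀ x κ, ‖(W x κ : 𝔸) - 1‖ ≤ σ) (B : LSite D → Fin D → 𝔸) (q : LSite D) (κ : Fin D) :
    ‖(L : ℝ) • Q0cov L W B q κ - linQ L B q κ‖ ≤
      2 * (((D : ℝ) + 1) * L * σ) * ((L : ℝ) * (((L : ℝ) ^ (D + 1))⁻¹)) *
        ∑ r : Fin D → Fin L, ∑ s ∈ Finset.range L, ‖B (q + boxVec L r + (s : ℤ) • e κ) κ‖ := by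
  have hσ0 : 0 ≤ σ := (norm_nonneg _).trans (hσ q κ)
  have hL0 : (0 : ℝ) < L := by exact_mod_cast hL
  rw [linQ_eq_smul_Q0form L hL, ← smul_sub, norm_smul, Real.norm_of_nonneg hL0.le]
  unfold Q0cov Q0form
  rw [← Finset.sum_sub_distrib]
  simp_rw [← smul_sub]
  have hr : ∀ r : Fin D → Fin L,
      ‖conjR (hol W q (treeWord (boxVec L r))) (tsum W B (q + boxVec L r) (seg κ L)) - asum B (q + boxVec L r) (seg κ L)‖ ≤
        2 * (((D : ℝ) + 1) * L * σ) * ∑ s ∈ Finset.range L, ‖B (q + boxVec L r + (s : ℤ) • e κ) κ‖ := by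
    intro r
    have hτ : ‖((hol W q (treeWord (boxVec L r)) : 𝔸ˣ) : 𝔸) - 1‖ ≤ D * L * σ := by
      refine (norm_hol_sub_one_le hW hσ q _).trans ?_
      rw [length_treeWord]
      exact mul_le_mul_of_nonneg_right (by exact_mod_cast l1_boxVec_le L r) hσ0
    refine (norm_conjR_tsum_seg_sub_asum_le hW hσ (hol_mem hW _ _) hτ B _ κ L).trans ?_
    refine mul_le_mul_of_nonneg_right ?_ (Finset.sum_nonneg fun _ _ => norm_nonneg _)
    nlinarith
  calc (L : ℝ) * ‖∑ r : Fin D → Fin L, (((L : ℝ) ^ (D + 1))⁻¹) •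
        (conjR (hol W q (treeWord (boxVec L r))) (tsum W B (q + boxVec L r) (seg κ L)) - asum B (q + boxVec L r) (seg κ L))‖
      ≤ (L : ℝ) * ∑ r : Fin D → Fin L, (((L : ℝ) ^ (D + 1))⁻¹) *
          (2 * (((D : ℝ) + 1) * L * σ) * ∑ s ∈ Finset.range L, ‖B (q + boxVec L r + (s : ℤ) • e κ) κ‖) := by
        refine mul_le_mul_of_nonneg_left ((norm_sum_le _ _).trans (Finset.sum_le_sum fun r _ => ?_)) hL0.le
        rw [norm_smul, Real.norm_of_nonneg (by positivity)]
        exact mul_le_mul_of_nonneg_left (hr r) (by positivity)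
    _ = _ := by
        rw [Finset.mul_sum, Finset.mul_sum]
        refine Finset.sum_congr rfl fun r _ => ?_
        ring

omit [Nontrivial 𝔸] in
/-- along ONE segment a single-bond bump is read at most once: `Σ_{s<n}‖(X·δ_{(y,μ)})(x + se_κ, κ)‖ ≤ ‖X‖`. [folklore] -/
private theorem sum_norm_bump_seg_le (y : LSite D) (μ : Fin D) (X : 𝔸) (x : LSite D) (κ : Fin D) (n : ℕ) :
    ∑ s ∈ Finset.range n, ‖bump y μ X (x + (s : ℤ) • e κ) κ‖ ≤ ‖X‖ := by
  classical
  by_cases h : ∃ s ∈ Finset.range n, x + (s : ℤ) • e κ = y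
  · obtain ⟨s₀, hs₀, hy⟩ := h
    rw [Finset.sum_eq_single_of_mem s₀ hs₀]
    · exact norm_bump_le y μ X _ κ
    · intro s _ hs
      rw [bump_eq_zero_of X, norm_zero]
      rintro ⟨h1, _⟩
      apply hs
      have h2 := congrFun (h1.trans hy.symm) κ
      simp [e_apply] at h2
      omega
  · refine (Finset.sum_eq_zero fun s hs => ?_).le.trans (norm_nonneg X)
    rw [bump_eq_zero_of X, norm_zero]
    rintro ⟨h1, _⟩
    exact h ⟨s, hs, h1⟩

omit [Nontrivial 𝔸] in
/-- over the whole box a single-bond bump is read at most `L` times: `Σ_{x∈B(c₋)}Σ_{s<L}‖(X·δ_b)([x + se_κ])‖ ≤ L‖X‖` (for each `s` at most one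
`x`, `x ↦ x + se_κ` being injective on the box). [cite: Balaban1985Averaging, (141) p.39, bookkeeping] -/
theorem sum_sum_norm_bump_le (y : LSite D) (μ : Fin D) (X : 𝔸) (q : LSite D) (κ : Fin D) :
    ∑ r : Fin D → Fin L, ∑ s ∈ Finset.range L, ‖bump y μ X (q + boxVec L r + (s : ℤ) • e κ) κ‖ ≤ L * ‖X‖ := by
  classical
  rw [Finset.sum_comm]
  have hs : ∀ s ∈ Finset.range L, ∑ r : Fin D → Fin L, ‖bump y μ X (q + boxVec L r + (s : ℤ) • e κ) κ‖ ≤ ‖X‖ := by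
    intro s _
    by_cases h : ∃ r : Fin D → Fin L, q + boxVec L r + (s : ℤ) • e κ = y
    · obtain ⟨r₀, hr₀⟩ := h
      rw [Finset.sum_eq_single r₀]
      · exact norm_bump_le y μ X _ κ
      · intro r _ hr
        rw [bump_eq_zero_of X, norm_zero]
        rintro ⟨h1, _⟩
        apply hr
        funext ν
        have h2 := congrFun (h1.trans hr₀.symm) ν
        simp only [Pi.add_apply, boxVec] at h2
        have h3 : ((r ν : ℕ) : ℤ) = r₀ ν := add_left_cancel (add_right_cancel h2)
        exact Fin.ext (by exact_mod_cast h3)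
      · intro h; exact absurd (Finset.mem_univ _) h
    · refine (Finset.sum_eq_zero fun r _ => ?_).le.trans (norm_nonneg X)
      rw [bump_eq_zero_of X, norm_zero]
      rintro ⟨h1, _⟩
      exact h ⟨r, h1⟩
  calc ∑ s ∈ Finset.range L, ∑ r : Fin D → Fin L, ‖bump y μ X (q + boxVec L r + (s : ℤ) • e κ) κ‖
      ≤ ∑ _s ∈ Finset.range L, ‖X‖ := Finset.sum_le_sum hs
    _ = L * ‖X‖ := by rw [Finset.sum_const, Finset.card_range, nsmul_eq_mul]

/-- ★ **THE ONE-STEP TRANSPORT DEFECT ON A BUMP**: `‖L·(Q₀(W)(X·δ_b))_c − L·(Q₀(1)(X·δ_b))_c‖ ≤ 2(d+1)Lσ·L·L^{−(d+1)}·L·‖X‖`.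
[cite: Balaban1985Averaging, (125) p.36, (139)–(141) p.39] -/
theorem norm_smul_Q0cov_sub_linQ_bump_le (hL : 1 ≤ L) {W : LSite D → Fin D → 𝔸ˣ} (hW : ∀ x κ, W x κ ∈ U1 𝔸) {σ : ℝ}
    (hσ : ∀ x κ, ‖(W x κ : 𝔸) - 1‖ ≤ σ) (y : LSite D) (μ : Fin D) (X : 𝔸) (q : LSite D) (κ : Fin D) :
    ‖(L : ℝ) • Q0cov L W (bump y μ X) q κ - linQ L (bump y μ X) q κ‖ ≤
      2 * (((D : ℝ) + 1) * L * σ) * ((L : ℝ) * (((L : ℝ) ^ (D + 1))⁻¹)) * (L * ‖X‖) := by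
  have hσ0 : 0 ≤ σ := (norm_nonneg _).trans (hσ q κ)
  exact (norm_smul_Q0cov_sub_linQ_le L hL hW hσ _ q κ).trans
    (mul_le_mul_of_nonneg_left (sum_sum_norm_bump_le L y μ X q κ) (by positivity))

omit [Nontrivial 𝔸] in
/-- the main term (125) is additive in the field. [cite: Balaban1985Averaging, (125) p.36, bookkeeping] -/
theorem Q0cov_add (W : LSite D → Fin D → 𝔸ˣ) (A B : LSite D → Fin D → 𝔸) (q : LSite D) (κ : Fin D) :
    Q0cov L W (A + B) q κ = Q0cov L W A q κ + Q0cov L W B q κ := by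
  unfold Q0cov
  rw [← Finset.sum_add_distrib]
  refine Finset.sum_congr rfl fun r _ => ?_
  rw [B7Prop3GeneralTild.tsum_add, conjR_add, smul_add]

omit [Nontrivial 𝔸] in
/-- the one-step defect operator `B ↦ L·(Q₀(W)B)_c − L·(Q₀(1)B)_c` is additive over finite sums. [cite: Balaban1985Averaging, (125) p.36, bookkeeping] -/
theorem smul_Q0cov_sub_linQ_finset_sum (W : LSite D → Fin D → 𝔸ˣ) {ι : Type*} (s : Finset ι) (F : ι → LSite D → Fin D → 𝔸)
    (q : LSite D) (κ : Fin D) :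
    (L : ℝ) • Q0cov L W (∑ i ∈ s, F i) q κ - linQ L (∑ i ∈ s, F i) q κ =
      ∑ i ∈ s, ((L : ℝ) • Q0cov L W (F i) q κ - linQ L (F i) q κ) := by
  classical
  induction s using Finset.induction_on with
  | empty => rw [Finset.sum_empty, Finset.sum_empty, Q0cov_zero_field, linQ_zero_field, smul_zero, sub_zero]
  | insert a s ha ih =>
      rw [Finset.sum_insert ha, Finset.sum_insert ha, Q0cov_add, linQ_add, ← ih, smul_add]
      abel

end Transport

/-! ## §4 The regime at level `j`: a background in [5] Prop. 5's class that is bondwise close to `1` -/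

section Regime

variable [Nontrivial 𝔸] {L : ℕ} (hL : 2 ≤ L) (hD : 1 ≤ D) {n : ℕ} {α ρ : ℝ} (hα : 0 < α) (hαQ : α ≤ alphaQ D L)
  {V : LSite D → Fin D → 𝔸ˣ} (hV : ∀ x κ, V x κ ∈ unitaryUnits 𝔸) (h52 : pdev V < α * (((L : ℝ) ^ n)⁻¹) ^ 2)
  (hρ : ∀ x κ, ‖(V x κ : 𝔸) - 1‖ ≤ ρ)

/-- the windows of Prop. 2 ∕ Prop. 3 inside `α ≤ α_Q(d, L)`: `C₀α ≤ 1/3`, `2α ≤ c₂′`, `1024(d+1)(d+4)L²α ≤ 1`.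
[cite: Balaban1985Averaging, Prop. 2 p.26, Prop. 5 p.42, (109) p.34] -/
theorem windows_of_alphaQ (hL : 2 ≤ L) (hD : 1 ≤ D) (hα : 0 < α) (hαQ : α ≤ alphaQ D L) :
    C0 D * α ≤ 1 / 3 ∧ 2 * α ≤ c2' D L ∧ 1024 * ((D : ℝ) + 1) * ((D : ℝ) + 4) * (L : ℝ) ^ 2 * α ≤ 1 := by
  have hL1 : 1 ≤ L := le_trans (by norm_num) hL
  have hLr : (1 : ℝ) ≤ L := by exact_mod_cast hL1
  refine ⟨(mul_le_mul_of_nonneg_left hαQ (C0_pos D).le).trans (C0_mul_alphaQ_le D L), ?_, ?_⟩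
  · have h4 := four_mul_alphaQ_le D L
    have hc := (B7Prop2Explicit.c2'_pos D L hL1).le
    linarith
  · have h : alphaQ D L ≤ 1 / (25600 * ((D : ℝ) + 1) ^ 2 * ((D : ℝ) + 4) * (L : ℝ) ^ (D + 1)) := min_le_right _ _
    have hpos : (0 : ℝ) < 25600 * ((D : ℝ) + 1) ^ 2 * ((D : ℝ) + 4) * (L : ℝ) ^ (D + 1) := by positivity
    have hD1 : (1 : ℝ) ≤ (D : ℝ) + 1 := by have : (0 : ℝ) ≤ D := Nat.cast_nonneg D; linarith
    have hL2 : (L : ℝ) ^ 2 ≤ (L : ℝ) ^ (D + 1) := pow_le_pow_right₀ hLr (by omega)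
    have key : 1024 * ((D : ℝ) + 1) * ((D : ℝ) + 4) * (L : ℝ) ^ 2 ≤ 25600 * ((D : ℝ) + 1) ^ 2 * ((D : ℝ) + 4) * (L : ℝ) ^ (D + 1) := by
      have h0 : (0 : ℝ) ≤ ((D : ℝ) + 1) * ((D : ℝ) + 4) := by positivity
      have k1 : ((D : ℝ) + 1) * ((D : ℝ) + 4) * (L : ℝ) ^ 2 ≤ ((D : ℝ) + 1) * ((D : ℝ) + 4) * (L : ℝ) ^ (D + 1) :=
        mul_le_mul_of_nonneg_left hL2 h0
      have hP : (0 : ℝ) ≤ ((D : ℝ) + 1) * ((D : ℝ) + 4) * (L : ℝ) ^ (D + 1) := by positivity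
      calc 1024 * ((D : ℝ) + 1) * ((D : ℝ) + 4) * (L : ℝ) ^ 2 = 1024 * (((D : ℝ) + 1) * ((D : ℝ) + 4) * (L : ℝ) ^ 2) := by ring
        _ ≤ 1024 * (((D : ℝ) + 1) * ((D : ℝ) + 4) * (L : ℝ) ^ (D + 1)) := mul_le_mul_of_nonneg_left k1 (by norm_num)
        _ ≤ (25600 * ((D : ℝ) + 1)) * (((D : ℝ) + 1) * ((D : ℝ) + 4) * (L : ℝ) ^ (D + 1)) :=
            mul_le_mul_of_nonneg_right (by nlinarith) hP
        _ = _ := by ring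
    calc 1024 * ((D : ℝ) + 1) * ((D : ℝ) + 4) * (L : ℝ) ^ 2 * α
        ≤ 25600 * ((D : ℝ) + 1) ^ 2 * ((D : ℝ) + 4) * (L : ℝ) ^ (D + 1) * (1 / (25600 * ((D : ℝ) + 1) ^ 2 * ((D : ℝ) + 4) * (L : ℝ) ^ (D + 1))) :=
          mul_le_mul key (hαQ.trans h) hα.le hpos.le
      _ = 1 := by field_simp

include hL hα hαQ hV h52 in
/-- **PROPOSITION 2 AT LEVEL `j`**: `Ū^j` is unitary-valued and `pdev Ū^j < 2α(Lʲ∕Lⁿ)²` (`j ≤ n`) — p. 37 «by this proposition the configurations Ū₀ʲ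
for j < k satisfy the assumptions of Proposition 3». [cite: Balaban1985Averaging, Prop. 2 (52)–(54) p.26, p.37 (after (127))] -/
theorem level_data (hD : 1 ≤ D) {j : ℕ} (hj : j ≤ n) :
    (∀ x κ, avgIter L V j x κ ∈ unitaryUnits 𝔸) ∧
      pdev (avgIter L V j) < 2 * (α * (((L : ℝ) ^ j) ^ 2 * (((L : ℝ) ^ n)⁻¹) ^ 2)) := by
  obtain ⟨hα3, hα2, -⟩ := windows_of_alphaQ (D := D) hL hD hα hαQ
  have hG := avgClosed_unitaryUnits (𝔸 := 𝔸) D L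
  have hLr : (2 : ℝ) ≤ L := by exact_mod_cast hL
  set r : ℝ := ((L : ℝ) ^ j) ^ 2 * (((L : ℝ) ^ n)⁻¹) ^ 2 with hr
  have hLj : 0 < (L : ℝ) ^ j := by positivity
  have hLn : 0 < (L : ℝ) ^ n := by positivity
  have hr0 : 0 < r := by positivity
  have hjn : (L : ℝ) ^ j ≤ (L : ℝ) ^ n := pow_le_pow_right₀ (by linarith) hj
  have hr1 : r ≤ 1 := by
    have h1 : (L : ℝ) ^ j * ((L : ℝ) ^ n)⁻¹ ≤ 1 := by rw [mul_inv_le_iff₀ hLn, one_mul]; exact hjn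
    have h0 : 0 ≤ (L : ℝ) ^ j * ((L : ℝ) ^ n)⁻¹ := by positivity
    have : r = ((L : ℝ) ^ j * ((L : ℝ) ^ n)⁻¹) ^ 2 := by rw [hr]; ring
    rw [this]; nlinarith
  have hα' : 0 < α * r := mul_pos hα hr0
  have hα'le : α * r ≤ α := mul_le_of_le_one_right hα.le hr1
  have h52' : pdev V < α * r * (((L : ℝ) ^ j)⁻¹) ^ 2 := by
    have : α * r * (((L : ℝ) ^ j)⁻¹) ^ 2 = α * (((L : ℝ) ^ n)⁻¹) ^ 2 := by rw [hr]; field_simp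
    rw [this]; exact h52
  have hα3' : C0 D * (α * r) ≤ 1 / 3 := (mul_le_mul_of_nonneg_left hα'le (C0_pos D).le).trans hα3
  have hα2' : 2 * (α * r) ≤ c2' D L := by linarith
  exact ⟨fun x κ => avgIter_mem L hL hG j V hV hα' hα3' hα2' h52' j le_rfl x κ,
    prop2_explicit_lt_two L hL hG j V hV hα' hα3' hα2' h52'⟩

include hL hα hαQ hV h52 in
/-- **THE BLOCK LOOPS AT LEVEL `j` ARE `ε_j`-CLOSE TO `1`**, `ε_j = 32(d+1)(d+4)L²·α(Lʲ∕Lⁿ)² ≤ 1/8` (Prop. 1 (47)∕(53) at the level background).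
[cite: Balaban1985Averaging, (53) p.26, p.25, (109) p.34] -/
theorem level_loops (hD : 1 ≤ D) {j : ℕ} (hj : j ≤ n) (q : LSite D) (κ : Fin D) (r : Fin D → Fin L) :
    ‖((Wcx L (avgIter L V j) q κ (boxVec L r) : 𝔸ˣ) : 𝔸) - 1‖ ≤
      2 * (8 * (D + 1) * (D + 4) * (L : ℝ) ^ 2 * (2 * (α * (((L : ℝ) ^ j) ^ 2 * (((L : ℝ) ^ n)⁻¹) ^ 2)))) := by
  have hL1 : 1 ≤ L := le_trans (by norm_num) hL
  obtain ⟨hmem, hpd⟩ := level_data (D := D) hL hα hαQ hV h52 hD hj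
  obtain ⟨-, -, h1024⟩ := windows_of_alphaQ (D := D) hL hD hα hαQ
  have hU1 : ∀ x κ, avgIter L V j x κ ∈ U1 𝔸 := fun x κ => B7Prop2Explicit.unitaryUnits_le_U1 (hmem x κ)
  set a : ℝ := 2 * (α * (((L : ℝ) ^ j) ^ 2 * (((L : ℝ) ^ n)⁻¹) ^ 2)) with ha
  have hr1 : ((L : ℝ) ^ j) ^ 2 * (((L : ℝ) ^ n)⁻¹) ^ 2 ≤ 1 := by
    have hLn : 0 < (L : ℝ) ^ n := by positivity
    have hjn : (L : ℝ) ^ j ≤ (L : ℝ) ^ n := pow_le_pow_right₀ (by exact_mod_cast hL1) hj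
    have h1 : (L : ℝ) ^ j * ((L : ℝ) ^ n)⁻¹ ≤ 1 := by rw [mul_inv_le_iff₀ hLn, one_mul]; exact hjn
    have h0 : 0 ≤ (L : ℝ) ^ j * ((L : ℝ) ^ n)⁻¹ := by positivity
    nlinarith
  have ha0 : 0 ≤ a := by positivity
  have ha2 : a ≤ 2 * α := by rw [ha]; nlinarith
  have hsmall : 512 * (D + 1) * (D + 4) * (L : ℝ) ^ 2 * a ≤ 1 := by
    have h0 : (0 : ℝ) ≤ 512 * ((D : ℝ) + 1) * ((D : ℝ) + 4) * (L : ℝ) ^ 2 := by positivity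
    nlinarith
  have h44 : ∀ (x : LSite D) (κ κ' : Fin D), κ ≠ κ' → ‖((hol (avgIter L V j) x (plaqWord κ κ') : 𝔸ˣ) : 𝔸) - 1‖ ≤ a :=
    fun x κ κ' _ => (le_pdev hU1 x κ κ').trans hpd.le
  exact norm_Wcx_sub_one_le L hL1 _ hU1 ha0 hsmall h44 q κ r

include hL hα hαQ hV h52 hρ in
/-- **THE LEVEL BACKGROUND IS BONDWISE CLOSE TO `1`**: `‖Ū^j(b) − 1‖ ≤ 16dα(Lʲ∕Lⁿ)² + Lʲρ` — the averaged bond is within `16dα(Lʲ∕Lⁿ)²` of the straight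
fine transporter (`avgIter_straight`), a product of `Lʲ` bond variables each `ρ`-close to `1`. [cite: Balaban1985Averaging, (42) p.23, p.25, Prop. 2 (52)–(54) p.26] -/
theorem level_close (hD : 1 ≤ D) {j : ℕ} (hj : j ≤ n) (x : LSite D) (κ : Fin D) :
    ‖((avgIter L V j x κ : 𝔸ˣ) : 𝔸) - 1‖ ≤ 16 * D * α * (((L : ℝ) ^ j) ^ 2 * (((L : ℝ) ^ n)⁻¹) ^ 2) + (L : ℝ) ^ j * ρ := by
  obtain ⟨hα3, hα2, -⟩ := windows_of_alphaQ (D := D) hL hD hα hαQ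
  have hG := avgClosed_unitaryUnits (𝔸 := 𝔸) D L
  have hVU : ∀ x κ, V x κ ∈ U1 𝔸 := fun x κ => B7Prop2Explicit.unitaryUnits_le_U1 (hV x κ)
  have h1 := avgIter_straight hD L hL hG n hV hα hα3 hα2 h52 j hj x κ
  have h2 : ‖((hol V (((L ^ j : ℕ) : ℤ) • x) (seg κ ((L ^ j : ℕ) : ℤ)) : 𝔸ˣ) : 𝔸) - 1‖ ≤ (L : ℝ) ^ j * ρ := by
    refine (norm_hol_sub_one_le hVU hρ _ _).trans ?_
    rw [length_seg, Int.natAbs_natCast, Nat.cast_pow]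
  exact (norm_sub_le_norm_sub_add_norm_sub _ _ _).trans (add_le_add h1 h2)

include hL hα hV h52 in
/-- a configuration with `pdev V < α(Lⁿ)⁻²` lies in print's class (1.7) on all of `ℤᵈ` up to level `n` (window `α`). [cite: Balaban1985RegularSpaces, (1.7) p.77] -/
theorem reg17_of_pdev : Reg17 L n (fun _ => (Set.univ : Set (LSite D))) α V := by
  have hL1 : 1 ≤ L := le_trans (by norm_num) hL
  have hLr : (1 : ℝ) ≤ L := by exact_mod_cast hL1
  have hVU : ∀ x κ, V x κ ∈ U1 𝔸 := fun x κ => B7Prop2Explicit.unitaryUnits_le_U1 (hV x κ)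
  intro j hj x μ ν _ _
  have hjn : (L : ℝ) ^ j ≤ (L : ℝ) ^ n := pow_le_pow_right₀ hLr hj
  have hLj : 0 < (L : ℝ) ^ j := by positivity
  have hmono : α * (((L : ℝ) ^ n)⁻¹) ^ 2 ≤ α * (((L : ℝ) ^ j)⁻¹) ^ 2 := by
    refine mul_le_mul_of_nonneg_left ?_ hα.le
    have := inv_anti₀ hLj hjn
    have h0 : 0 ≤ ((L : ℝ) ^ n)⁻¹ := by positivity
    nlinarith
  exact ((le_pdev hVU x μ ν).trans_lt h52).trans_le hmono

include hL hα hαQ hV h52 in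
/-- **THE COLUMN BOUND (147) AT EVERY LEVEL `j ≤ n`**: `‖LʲQ_j(V)(X·δ_b)(c)‖ ≤ 2·Lʲ·L^{−jd}·‖X‖`. [cite: Balaban1985Averaging, (147) p.40] -/
theorem norm_column_le {j : ℕ} (hj : j ≤ n) (y : LSite D) (μ : Fin D) (X : 𝔸) (w : LSite D) (κ : Fin D) :
    ‖linCovIter L V (bump y μ X) j w κ‖ ≤ 2 * ((L : ℝ) ^ j * (((L : ℝ) ^ j) ^ D)⁻¹) * ‖X‖ := by
  have hL1 : 1 ≤ L := le_trans (by norm_num) hL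
  have h := norm_linCovIter_bump_le_of_reg17 hL hα hαQ hV (reg17_of_pdev hL hα hV h52) hj w κ (fun _ _ => Set.mem_univ _) y μ X
  refine h.trans (mul_le_mul_of_nonneg_right (mul_le_mul_of_nonneg_right ?_ (by positivity)) (norm_nonneg _))
  have := thetaGen_le_one (D := D) hL1 hαQ
  linarith

include hL hα hαQ hV h52 hρ in
/-- ★★ **THE ONE-STEP DEFECT AT LEVEL `j < n`**: the column field `F_{j+1} = Q(Ū^j)F_j` differs from the FLAT one-step `L·Q₀(1)F_j` of the previous column
field by at most `κ_j·Lʲ·L^{−jd}·‖X‖` at every coarse bond, `κ_j = 3200(d+1)²(d+4)L³·α(Lʲ∕Lⁿ)² + 8d(d+1)L³L^{−(d+1)}·(16dα(Lʲ∕Lⁿ)² + Lʲρ)` — the frame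
part (126) plus the transport part of (125). [cite: Balaban1985Averaging, (122)–(126) p.36, (139)–(141) p.39, p.38] -/
theorem norm_defect_le (hD : 1 ≤ D) {j : ℕ} (hj : j + 1 ≤ n) (y : LSite D) (μ : Fin D) (X : 𝔸) (z : LSite D) (κ : Fin D) :
    ‖linCovIter L V (bump y μ X) (j + 1) z κ - linQ L (linCovIter L V (bump y μ X) j) ((L : ℤ) • z) κ‖ ≤
      (3200 * ((D : ℝ) + 1) ^ 2 * ((D : ℝ) + 4) * (L : ℝ) ^ 3 * (α * (((L : ℝ) ^ j) ^ 2 * (((L : ℝ) ^ n)⁻¹) ^ 2)) +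
        8 * D * ((D : ℝ) + 1) * ((L : ℝ) ^ 3 * ((L : ℝ) ^ (D + 1))⁻¹) *
          (16 * D * α * (((L : ℝ) ^ j) ^ 2 * (((L : ℝ) ^ n)⁻¹) ^ 2) + (L : ℝ) ^ j * ρ)) *
        ((L : ℝ) ^ j * (((L : ℝ) ^ j) ^ D)⁻¹) * ‖X‖ := by
  have hL1 : 1 ≤ L := le_trans (by norm_num) hL
  have hL0 : (0 : ℝ) < L := by exact_mod_cast (lt_of_lt_of_le (by norm_num) hL)
  have hj' : j ≤ n := (Nat.le_succ j).trans hj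
  obtain ⟨hmem, hpd⟩ := level_data (D := D) hL hα hαQ hV h52 hD hj'
  obtain ⟨-, -, h1024⟩ := windows_of_alphaQ (D := D) hL hD hα hαQ
  have hU1 : ∀ x κ, avgIter L V j x κ ∈ U1 𝔸 := fun x κ => B7Prop2Explicit.unitaryUnits_le_U1 (hmem x κ)
  -- abbreviations
  set W := avgIter L V j with hW
  set F := linCovIter L V (bump y μ X) j with hF
  set rj : ℝ := ((L : ℝ) ^ j) ^ 2 * (((L : ℝ) ^ n)⁻¹) ^ 2 with hrj
  set lam : ℝ := (L : ℝ) ^ j * (((L : ℝ) ^ j) ^ D)⁻¹ with hlam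
  set ε : ℝ := 2 * (8 * (D + 1) * (D + 4) * (L : ℝ) ^ 2 * (2 * (α * rj))) with hε
  set σ : ℝ := 16 * D * α * rj + (L : ℝ) ^ j * ρ with hσ
  have hrj0 : 0 ≤ rj := by positivity
  have hrj1 : rj ≤ 1 := by
    have hLn : 0 < (L : ℝ) ^ n := by positivity
    have hjn : (L : ℝ) ^ j ≤ (L : ℝ) ^ n := pow_le_pow_right₀ (by exact_mod_cast hL1) hj'
    have h1 : (L : ℝ) ^ j * ((L : ℝ) ^ n)⁻¹ ≤ 1 := by rw [mul_inv_le_iff₀ hLn, one_mul]; exact hjn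
    have h0 : 0 ≤ (L : ℝ) ^ j * ((L : ℝ) ^ n)⁻¹ := by positivity
    have : rj = ((L : ℝ) ^ j * ((L : ℝ) ^ n)⁻¹) ^ 2 := by rw [hrj]; ring
    rw [this]; nlinarith
  have hlam0 : 0 ≤ lam := by positivity
  have hε0 : 0 ≤ ε := by positivity
  have hε8 : ε ≤ 1 / 8 := by
    rw [hε]
    have h0 : (0 : ℝ) ≤ ((D : ℝ) + 1) * ((D : ℝ) + 4) * (L : ℝ) ^ 2 * α := by positivity
    nlinarith
  -- the sup bound of the previous column field and the block loops of the level background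
  have hFb : ∀ x κ', ‖F x κ'‖ ≤ 2 * lam * ‖X‖ := fun x κ' => norm_column_le hL hα hαQ hV h52 hj' y μ X x κ'
  have hloops : ∀ r : Fin D → Fin L, ‖((Wcx L W ((L : ℤ) • z) κ (boxVec L r) : 𝔸ˣ) : 𝔸) - 1‖ ≤ ε :=
    fun r => level_loops hL hα hαQ hV h52 hD hj' _ κ r
  -- term 1: the frame part (126)
  have h1 : ‖linQcov L W F ((L : ℤ) • z) κ - (L : ℝ) • Q0cov L W F ((L : ℤ) • z) κ‖ ≤ 50 * (D + 1) * ε * L * (2 * lam * ‖X‖) :=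
    norm_linQcov_sub_main_le L hU1 (by positivity) hFb hL1 _ κ hε0 hε8 hloops
  -- term 2: the transport part of the main term (125), through the window decomposition of `F`
  have hσb : ∀ x κ', ‖((W x κ' : 𝔸ˣ) : 𝔸) - 1‖ ≤ σ := fun x κ' => level_close hL hα hαQ hV h52 hρ hD hj' x κ'
  have hG : ∀ w κ', ¬ InBox (loK L j w) (bondHiK L j w κ') y → F w κ' = 0 :=
    fun w κ' hn => linCovIter_bump_eq_zero_of_not_inBox L hL1 V hn μ X
  have h2 : ‖(L : ℝ) • Q0cov L W F ((L : ℤ) • z) κ - linQ L F ((L : ℤ) • z) κ‖ ≤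
      D * (2 * (2 * (((D : ℝ) + 1) * L * σ) * ((L : ℝ) * (((L : ℝ) ^ (D + 1))⁻¹)) * (L * (2 * lam * ‖X‖)))) := by
    have hdec := eq_sum_bump_window L hL1 hG
    have hσ0 : 0 ≤ σ := (norm_nonneg _).trans (hσb z κ)
    calc ‖(L : ℝ) • Q0cov L W F ((L : ℤ) • z) κ - linQ L F ((L : ℤ) • z) κ‖
        = ‖∑ κ' : Fin D, ∑ t : Fin 2, ((L : ℝ) • Q0cov L W (bump (winBase L j y κ' t) κ' (F (winBase L j y κ' t) κ')) ((L : ℤ) • z) κ -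
            linQ L (bump (winBase L j y κ' t) κ' (F (winBase L j y κ' t) κ')) ((L : ℤ) • z) κ)‖ := by
          conv_lhs => rw [hdec]
          rw [smul_Q0cov_sub_linQ_finset_sum]
          congr 1
          refine Finset.sum_congr rfl fun κ' _ => ?_
          rw [smul_Q0cov_sub_linQ_finset_sum]
      _ ≤ ∑ κ' : Fin D, ∑ t : Fin 2, 2 * (((D : ℝ) + 1) * L * σ) * ((L : ℝ) * (((L : ℝ) ^ (D + 1))⁻¹)) * (L * (2 * lam * ‖X‖)) := by
          refine (norm_sum_le _ _).trans (Finset.sum_le_sum fun κ' _ => (norm_sum_le _ _).trans (Finset.sum_le_sum fun t _ => ?_))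
          refine (norm_smul_Q0cov_sub_linQ_bump_le L hL1 hU1 hσb _ κ' _ _ κ).trans ?_
          refine mul_le_mul_of_nonneg_left (mul_le_mul_of_nonneg_left (hFb _ _) hL0.le) (by positivity)
      _ = _ := by
          rw [Finset.sum_const, Finset.sum_const, Finset.card_univ, Finset.card_univ, Fintype.card_fin, Fintype.card_fin]
          simp only [nsmul_eq_mul]
          push_cast
          ring
  -- assemble
  rw [linCovIter_succ]
  have hsplit : linQcov L W F ((L : ℤ) • z) κ - linQ L F ((L : ℤ) • z) κ =
      (linQcov L W F ((L : ℤ) • z) κ - (L : ℝ) • Q0cov L W F ((L : ℤ) • z) κ) +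
        ((L : ℝ) • Q0cov L W F ((L : ℤ) • z) κ - linQ L F ((L : ℤ) • z) κ) := by abel
  rw [hsplit]
  refine (norm_add_le _ _).trans ((add_le_add h1 h2).trans (le_of_eq ?_))
  rw [hε, hσ]
  ring

omit [Nontrivial 𝔸] in
include hL in
/-- **THE SUPPORT OF THE ONE-STEP DEFECT IS THE WINDOW ONE LEVEL UP**: off the window bonds of `y` at level `j + 1` both the column field `F_{j+1}` and the flat
one-step of `F_j` vanish. [cite: Balaban1985Averaging, p.24, (141) p.39] -/
theorem defect_eq_zero_of_not_inBox {j : ℕ} (y : LSite D) (μ : Fin D) (X : 𝔸) {z : LSite D} {κ : Fin D}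
    (hz : ¬ InBox (loK L (j + 1) z) (bondHiK L (j + 1) z κ) y) :
    linCovIter L V (bump y μ X) (j + 1) z κ - linQ L (linCovIter L V (bump y μ X) j) ((L : ℤ) • z) κ = 0 := by
  have hL1 : 1 ≤ L := le_trans (by norm_num) hL
  have hG : ∀ w κ', ¬ InBox (loK L j w) (bondHiK L j w κ') y → linCovIter L V (bump y μ X) j w κ' = 0 :=
    fun w κ' hn => linCovIter_bump_eq_zero_of_not_inBox L hL1 V hn μ X
  rw [linCovIter_bump_eq_zero_of_not_inBox L hL1 V hz μ X, zero_sub, neg_eq_zero]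
  by_contra hne
  exact hz (linQ_support_of_window L hG hne)

end Regime

/-! ## §5 The Duhamel induction over the flat composite and the flatness estimate -/

section Flatness

variable [Nontrivial 𝔸] {L : ℕ} (hL : 2 ≤ L) (hD : 1 ≤ D) {n : ℕ} {α ρ : ℝ} (hα : 0 < α) (hαQ : α ≤ alphaQ D L)
  {V : LSite D → Fin D → 𝔸ˣ} (hV : ∀ x κ, V x κ ∈ unitaryUnits 𝔸) (h52 : pdev V < α * (((L : ℝ) ^ n)⁻¹) ^ 2)
  (hρ : ∀ x κ, ‖(V x κ : 𝔸) - 1‖ ≤ ρ)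

omit [Nontrivial 𝔸] in
/-- the scale bookkeeping of the induction: `λ_m·λ_j = (L^d∕L)·λ_{j+1+m}`, `λ_k = Lᵏ·L^{−kd}`. [folklore] -/
private theorem lam_mul_lam (hL : 2 ≤ L) (m j : ℕ) :
    ((L : ℝ) ^ m * (((L : ℝ) ^ m) ^ D)⁻¹) * ((L : ℝ) ^ j * (((L : ℝ) ^ j) ^ D)⁻¹) =
      ((L : ℝ) ^ D * (L : ℝ)⁻¹) * ((L : ℝ) ^ (j + 1 + m) * (((L : ℝ) ^ (j + 1 + m)) ^ D)⁻¹) := by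
  have hL0 : (L : ℝ) ≠ 0 := by exact_mod_cast (show L ≠ 0 by omega)
  rw [← pow_mul, ← pow_mul, ← pow_mul]
  field_simp
  ring

omit [Nontrivial 𝔸] in
/-- `Σ_{j<n} xʲ ≤ xⁿ − 1` for `x ≥ 2`. [folklore] -/
private theorem geom_sum_le_pow_sub_one {x : ℝ} (hx : 2 ≤ x) : ∀ n : ℕ, ∑ j ∈ Finset.range n, x ^ j ≤ x ^ n - 1
  | 0 => by simp
  | n + 1 => by
    rw [Finset.sum_range_succ, pow_succ]
    have ih := geom_sum_le_pow_sub_one hx n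
    have h0 : 0 ≤ x ^ n := by positivity
    nlinarith

include hL in
/-- ★★ **THE DUHAMEL INDUCTION OVER THE FLAT COMPOSITE**: if the one-step defects `e_j = F_{j+1} − L·Q₀(1)F_j` of the column fields `F_j = LʲQ_j(V)(X·δ_b)` are
window-supported and bounded by `κ_j·λ_j·‖X‖` (`λ_j = Lʲ·L^{−jd}`), then `Φ_m F_j − Φ_{j+m}(X·δ_b)` is bounded at every coarse bond by
`4d·(L^d∕L)·(Σ_{i<j} κ_i)·λ_{j+m}·‖X‖` — `Φ_m F_{j+1} = Φ_m e_j + Φ_{m+1} F_j` (additivity, `Φ_m∘Φ_1 = Φ_{m+1}`), `e_j` is the sum of its `2d` window bumps, and the flat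
column bound (147) gives `‖Φ_m(bump)‖ ≤ 2λ_m·‖·‖`, `λ_m·λ_j = (L^d∕L)·λ_{j+1+m}`. [cite: Balaban1985Averaging, (141)–(147) pp.39–40, p.38] -/
theorem duhamel (y : LSite D) (μ : Fin D) (X : 𝔸) {kap : ℕ → ℝ}
    (hdef : ∀ j, j + 1 ≤ n → ∀ (z : LSite D) (κ : Fin D),
      ‖linCovIter L V (bump y μ X) (j + 1) z κ - linQ L (linCovIter L V (bump y μ X) j) ((L : ℤ) • z) κ‖ ≤
        kap j * ((L : ℝ) ^ j * (((L : ℝ) ^ j) ^ D)⁻¹) * ‖X‖)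
    (hsupp : ∀ j (z : LSite D) (κ : Fin D), ¬ InBox (loK L (j + 1) z) (bondHiK L (j + 1) z κ) y →
      linCovIter L V (bump y μ X) (j + 1) z κ - linQ L (linCovIter L V (bump y μ X) j) ((L : ℤ) • z) κ = 0) :
    ∀ j, j ≤ n → ∀ (m N : ℕ), j + m = N → ∀ (z : LSite D) (κ : Fin D),
      ‖linQIter L (linCovIter L V (bump y μ X) j) m z κ - linQIter L (bump y μ X) N z κ‖ ≤
        4 * D * ((L : ℝ) ^ D * (L : ℝ)⁻¹) * (∑ i ∈ Finset.range j, kap i) * ((L : ℝ) ^ N * (((L : ℝ) ^ N) ^ D)⁻¹) * ‖X‖ := by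
  have hL1 : 1 ≤ L := le_trans (by norm_num) hL
  intro j
  induction j with
  | zero =>
      intro _ m N hN z κ
      rw [zero_add] at hN
      subst hN
      rw [linCovIter_zero, sub_self, norm_zero, Finset.sum_range_zero]
      simp
  | succ j ih =>
      intro hj1 m N hN z κ
      have hj : j ≤ n := (Nat.le_succ j).trans hj1
      -- the defect field at level `j` and its window decomposition
      set F := linCovIter L V (bump y μ X) j with hF
      set e : LSite D → Fin D → 𝔸 := fun z κ => linCovIter L V (bump y μ X) (j + 1) z κ - linQ L F ((L : ℤ) • z) κ with he
      have hsplit : linCovIter L V (bump y μ X) (j + 1) = e + fun z κ => linQ L F ((L : ℤ) • z) κ := by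
        funext z κ; simp [he]
      have hG : ∀ w κ', ¬ InBox (loK L (j + 1) w) (bondHiK L (j + 1) w κ') y → e w κ' = 0 := fun w κ' hw => hsupp j w κ' hw
      have hdec := eq_sum_bump_window L hL1 hG
      -- `Φ_m F_{j+1} = Φ_m e + Φ_{m+1} F_j`
      have hΦ : linQIter L (linCovIter L V (bump y μ X) (j + 1)) m z κ =
          linQIter L e m z κ + linQIter L F (m + 1) z κ := by
        rw [hsplit, linQIter_add', Pi.add_apply, Pi.add_apply, linQIter_succ_left]
      -- the induction hypothesis one flat step further
      have hIH := ih hj (m + 1) N (by omega) z κ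
      -- the defect term through the window bumps and the flat column bound
      have hlam0 : 0 ≤ (L : ℝ) ^ m * (((L : ℝ) ^ m) ^ D)⁻¹ := by positivity
      have hterm : ‖linQIter L e m z κ‖ ≤
          4 * D * ((L : ℝ) ^ D * (L : ℝ)⁻¹) * kap j * ((L : ℝ) ^ N * (((L : ℝ) ^ N) ^ D)⁻¹) * ‖X‖ := by
        have hkap0 : 0 ≤ kap j * ((L : ℝ) ^ j * (((L : ℝ) ^ j) ^ D)⁻¹) * ‖X‖ := (norm_nonneg _).trans (hdef j hj1 z κ)
        calc ‖linQIter L e m z κ‖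
            = ‖∑ κ' : Fin D, ∑ t : Fin 2, linQIter L (bump (winBase L (j + 1) y κ' t) κ' (e (winBase L (j + 1) y κ' t) κ')) m z κ‖ := by
              conv_lhs => rw [hdec]
              rw [linQIter_finset_sum, Finset.sum_apply, Finset.sum_apply]
              congr 1
              refine Finset.sum_congr rfl fun κ' _ => ?_
              rw [linQIter_finset_sum, Finset.sum_apply, Finset.sum_apply]
          _ ≤ ∑ κ' : Fin D, ∑ t : Fin 2, 2 * ((L : ℝ) ^ m * (((L : ℝ) ^ m) ^ D)⁻¹) * (kap j * ((L : ℝ) ^ j * (((L : ℝ) ^ j) ^ D)⁻¹) * ‖X‖) := by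
              refine (norm_sum_le _ _).trans (Finset.sum_le_sum fun κ' _ => (norm_sum_le _ _).trans (Finset.sum_le_sum fun t _ => ?_))
              exact (norm_linQIter_bump_le hL _ κ' _ m z κ).trans (mul_le_mul_of_nonneg_left (hdef j hj1 _ κ') (by positivity))
          _ = 4 * D * (((L : ℝ) ^ m * (((L : ℝ) ^ m) ^ D)⁻¹) * ((L : ℝ) ^ j * (((L : ℝ) ^ j) ^ D)⁻¹)) * kap j * ‖X‖ := by
              rw [Finset.sum_const, Finset.sum_const, Finset.card_univ, Finset.card_univ, Fintype.card_fin, Fintype.card_fin]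
              simp only [nsmul_eq_mul]
              push_cast
              ring
          _ = _ := by rw [lam_mul_lam (D := D) hL m j, show j + 1 + m = N by omega]; ring
      rw [hΦ, add_sub_assoc]
      refine (norm_add_le _ _).trans ((add_le_add hterm hIH).trans (le_of_eq ?_))
      rw [Finset.sum_range_succ]
      ring

include hL hD hα hαQ hV h52 hρ in
/-- ★★★ **THE FLATNESS ESTIMATE, LEVEL-COEFFICIENT FORM**: for `L ≥ 2`, `d ≥ 1`, a unitary background `V` in the regime `pdev V < α(Lⁿ)⁻²`, `0 < α ≤ α_Q(d,L)`,
bondwise `ρ`-close to `1`, every fine bond `(y, μ)`, `X`, level-`n` bond `(w, κ)`: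
`‖LⁿQ_n(V)(X·δ_{(y,μ)})(w,κ) − LⁿQ_n(1)(X·δ_{(y,μ)})(w,κ)‖ ≤ 4d(L^d∕L)·(Σ_{j<n} κ_j)·Lⁿ·L^{−nd}·‖X‖` with the level coefficients `κ_j` of `norm_defect_le`.
[cite: Balaban1985Averaging, (139)–(147) pp.39–40 («the constant C₁ depends on d and L»), (127) p.37] -/
theorem norm_linCovIter_bump_sub_linQIter_le_sum (y : LSite D) (μ : Fin D) (X : 𝔸) (w : LSite D) (κ : Fin D) :
    ‖linCovIter L V (bump y μ X) n w κ - linQIter L (bump y μ X) n w κ‖ ≤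
      4 * D * ((L : ℝ) ^ D * (L : ℝ)⁻¹) *
        (∑ j ∈ Finset.range n,
          (3200 * ((D : ℝ) + 1) ^ 2 * ((D : ℝ) + 4) * (L : ℝ) ^ 3 * (α * (((L : ℝ) ^ j) ^ 2 * (((L : ℝ) ^ n)⁻¹) ^ 2)) +
            8 * D * ((D : ℝ) + 1) * ((L : ℝ) ^ 3 * ((L : ℝ) ^ (D + 1))⁻¹) *
              (16 * D * α * (((L : ℝ) ^ j) ^ 2 * (((L : ℝ) ^ n)⁻¹) ^ 2) + (L : ℝ) ^ j * ρ))) *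
        ((L : ℝ) ^ n * (((L : ℝ) ^ n) ^ D)⁻¹) * ‖X‖ := by
  have h := duhamel hL y μ X (fun j hj z κ' => norm_defect_le hL hα hαQ hV h52 hρ hD hj y μ X z κ')
    (fun j z κ' hz => defect_eq_zero_of_not_inBox hL y μ X hz) n le_rfl 0 n (by omega) w κ
  rwa [linQIter_zero] at h

include hL hD hα hαQ hV h52 hρ in
/-- ★★★ **THE FLATNESS ESTIMATE, UNIFORM IN `n`**: under the same hypotheses (and `ρ ≥ 0`),
`‖LⁿQ_n(V)(X·δ_{(y,μ)})(w,κ) − LⁿQ_n(1)(X·δ_{(y,μ)})(w,κ)‖ ≤ 4d·L^d·[(3200(d+1)²(d+4)L³ + 128d²(d+1)L³L^{−(d+1)})·α + 8d(d+1)L³L^{−(d+1)}·Lⁿρ]·Lⁿ·L^{−nd}·‖X‖`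
— the geometric sums `Σ_{j<n}(Lʲ∕Lⁿ)² ≤ 1`, `Σ_{j<n}Lʲ ≤ Lⁿ`; «the constant C₁ depends on d and L» and on nothing else. In the gauge of file F2, `ρ = O(α₀L^{−n})`,
so the bound is `C(d,L)·α₀·Lⁿ·L^{−nd}·‖X‖`, the scale of hypothesis (H1) of `B9B8KnitAveragingClosenessOfColumns`. [cite: Balaban1985Averaging, (139)–(147) pp.39–40, (127) p.37] -/
theorem norm_linCovIter_bump_sub_linQIter_le (hρ0 : 0 ≤ ρ) (y : LSite D) (μ : Fin D) (X : 𝔸) (w : LSite D) (κ : Fin D) :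
    ‖linCovIter L V (bump y μ X) n w κ - linQIter L (bump y μ X) n w κ‖ ≤
      4 * D * (L : ℝ) ^ D *
        ((3200 * ((D : ℝ) + 1) ^ 2 * ((D : ℝ) + 4) * (L : ℝ) ^ 3 + 128 * (D : ℝ) ^ 2 * ((D : ℝ) + 1) * ((L : ℝ) ^ 3 * ((L : ℝ) ^ (D + 1))⁻¹)) * α +
          8 * D * ((D : ℝ) + 1) * ((L : ℝ) ^ 3 * ((L : ℝ) ^ (D + 1))⁻¹) * ((L : ℝ) ^ n * ρ)) *
        ((L : ℝ) ^ n * (((L : ℝ) ^ n) ^ D)⁻¹) * ‖X‖ := by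
  have hL1 : 1 ≤ L := le_trans (by norm_num) hL
  have hLr : (2 : ℝ) ≤ L := by exact_mod_cast hL
  have hL0 : (0 : ℝ) < L := by linarith
  refine (norm_linCovIter_bump_sub_linQIter_le_sum hL hD hα hαQ hV h52 hρ y μ X w κ).trans ?_
  -- the two geometric sums
  have hS2 : ∑ j ∈ Finset.range n, ((L : ℝ) ^ j) ^ 2 * (((L : ℝ) ^ n)⁻¹) ^ 2 ≤ 1 := by
    have hx : (2 : ℝ) ≤ (L : ℝ) ^ 2 := by nlinarith
    have h := geom_sum_le_pow_sub_one hx n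
    have hLn : 0 < ((L : ℝ) ^ n) ^ 2 := by positivity
    have hre : ∀ j, ((L : ℝ) ^ j) ^ 2 * (((L : ℝ) ^ n)⁻¹) ^ 2 = ((L : ℝ) ^ 2) ^ j * (((L : ℝ) ^ n) ^ 2)⁻¹ := fun j => by
      rw [← pow_mul, ← pow_mul, inv_pow, mul_comm 2 j]
    simp_rw [hre, ← Finset.sum_mul]
    rw [mul_inv_le_iff₀ hLn, one_mul, ← pow_mul, mul_comm n 2, pow_mul]
    linarith
  have hS1 : ∑ j ∈ Finset.range n, (L : ℝ) ^ j ≤ (L : ℝ) ^ n := by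
    have h := geom_sum_le_pow_sub_one hLr n; linarith
  -- abbreviations for the constants
  set A : ℝ := 3200 * ((D : ℝ) + 1) ^ 2 * ((D : ℝ) + 4) * (L : ℝ) ^ 3 with hA
  set B : ℝ := 8 * D * ((D : ℝ) + 1) * ((L : ℝ) ^ 3 * ((L : ℝ) ^ (D + 1))⁻¹) with hB
  have hA0 : 0 ≤ A := by positivity
  have hB0 : 0 ≤ B := by positivity
  have hsum : ∑ j ∈ Finset.range n, (A * (α * (((L : ℝ) ^ j) ^ 2 * (((L : ℝ) ^ n)⁻¹) ^ 2)) +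
      B * (16 * D * α * (((L : ℝ) ^ j) ^ 2 * (((L : ℝ) ^ n)⁻¹) ^ 2) + (L : ℝ) ^ j * ρ)) ≤
        (A + 128 * (D : ℝ) ^ 2 * ((D : ℝ) + 1) * ((L : ℝ) ^ 3 * ((L : ℝ) ^ (D + 1))⁻¹)) * α + B * ((L : ℝ) ^ n * ρ) := by
    have hrew : ∑ j ∈ Finset.range n, (A * (α * (((L : ℝ) ^ j) ^ 2 * (((L : ℝ) ^ n)⁻¹) ^ 2)) +
        B * (16 * D * α * (((L : ℝ) ^ j) ^ 2 * (((L : ℝ) ^ n)⁻¹) ^ 2) + (L : ℝ) ^ j * ρ)) =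
        (A * α + B * (16 * D * α)) * ∑ j ∈ Finset.range n, ((L : ℝ) ^ j) ^ 2 * (((L : ℝ) ^ n)⁻¹) ^ 2 +
          B * ρ * ∑ j ∈ Finset.range n, (L : ℝ) ^ j := by
      rw [Finset.mul_sum, Finset.mul_sum, ← Finset.sum_add_distrib]
      refine Finset.sum_congr rfl fun j _ => ?_
      ring
    rw [hrew]
    have hD0 : (0 : ℝ) ≤ D := Nat.cast_nonneg D
    have hc1 : 0 ≤ A * α + B * (16 * D * α) := by positivity
    have hc2 : 0 ≤ B * ρ := by positivity
    have e128 : B * (16 * D * α) = 128 * (D : ℝ) ^ 2 * ((D : ℝ) + 1) * ((L : ℝ) ^ 3 * ((L : ℝ) ^ (D + 1))⁻¹) * α := by rw [hB]; ring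
    calc (A * α + B * (16 * D * α)) * ∑ j ∈ Finset.range n, ((L : ℝ) ^ j) ^ 2 * (((L : ℝ) ^ n)⁻¹) ^ 2 + B * ρ * ∑ j ∈ Finset.range n, (L : ℝ) ^ j
        ≤ (A * α + B * (16 * D * α)) * 1 + B * ρ * (L : ℝ) ^ n :=
          add_le_add (mul_le_mul_of_nonneg_left hS2 hc1) (mul_le_mul_of_nonneg_left hS1 hc2)
      _ = _ := by rw [e128]; ring
  have hlamn : 0 ≤ (L : ℝ) ^ n * (((L : ℝ) ^ n) ^ D)⁻¹ := by positivity
  have hpre : 0 ≤ 4 * D * ((L : ℝ) ^ D * (L : ℝ)⁻¹) := by positivity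
  have hLD : (L : ℝ) ^ D * (L : ℝ)⁻¹ ≤ (L : ℝ) ^ D := by
    have : (L : ℝ)⁻¹ ≤ 1 := inv_le_one_of_one_le₀ (by linarith)
    have h0 : 0 ≤ (L : ℝ) ^ D := by positivity
    nlinarith
  have hK0 : 0 ≤ (A + 128 * (D : ℝ) ^ 2 * ((D : ℝ) + 1) * ((L : ℝ) ^ 3 * ((L : ℝ) ^ (D + 1))⁻¹)) * α + B * ((L : ℝ) ^ n * ρ) := by positivity
  calc 4 * D * ((L : ℝ) ^ D * (L : ℝ)⁻¹) * (∑ j ∈ Finset.range n, (A * (α * (((L : ℝ) ^ j) ^ 2 * (((L : ℝ) ^ n)⁻¹) ^ 2)) +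
          B * (16 * D * α * (((L : ℝ) ^ j) ^ 2 * (((L : ℝ) ^ n)⁻¹) ^ 2) + (L : ℝ) ^ j * ρ))) * ((L : ℝ) ^ n * (((L : ℝ) ^ n) ^ D)⁻¹) * ‖X‖
      ≤ 4 * D * (L : ℝ) ^ D * ((A + 128 * (D : ℝ) ^ 2 * ((D : ℝ) + 1) * ((L : ℝ) ^ 3 * ((L : ℝ) ^ (D + 1))⁻¹)) * α + B * ((L : ℝ) ^ n * ρ)) *
          ((L : ℝ) ^ n * (((L : ℝ) ^ n) ^ D)⁻¹) * ‖X‖ := by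
        have hD0 : (0 : ℝ) ≤ D := Nat.cast_nonneg D
        refine mul_le_mul_of_nonneg_right (mul_le_mul_of_nonneg_right ?_ hlamn) (norm_nonneg _)
        calc 4 * D * ((L : ℝ) ^ D * (L : ℝ)⁻¹) * _ ≤ 4 * D * ((L : ℝ) ^ D * (L : ℝ)⁻¹) * _ := mul_le_mul_of_nonneg_left hsum hpre
          _ ≤ 4 * D * (L : ℝ) ^ D * _ := by
              refine mul_le_mul_of_nonneg_right ?_ hK0
              exact mul_le_mul_of_nonneg_left hLD (by positivity)
    _ = _ := by rw [hA, hB]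

end Flatness

end Literature.MathematicalPhysics.QuantumFieldTheory.Balaban1983to89.B9B8KnitColumnFlatness
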